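import Summits.HodgeConjecture.HodgeConjecture.Theses.EndoscopicMiddleDegree
import Summits.HodgeConjecture.HodgeConjecture.Theorems.EndoscopicMiddleDegreeOrthogonalEnvelopedHeckeGraphAnalytic
import Summits.HodgeConjecture.HodgeConjecture.Theorems.EndoscopicMiddleDegreeOrthogonalEnvelopedRationalBlocks
import Summits.HodgeConjecture.HodgeConjecture.Theorems.EndoscopicMiddleDegreeOrthogonalEnvelopedKilledBarren
import Summits.HodgeConjecture.HodgeConjecture.Theorems.EndoscopicMiddleDegreeMiddleThetaSpanHeckeIdempotents
import Summits.HodgeConjecture.HodgeConjecture.Theorems.EndoscopicMiddleDegreeOrthogonalEnvelopedLevelCoverCompactT2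
import Summits.HodgeConjecture.HodgeConjecture.Theorems.EndoscopicMiddleDegreeOrthogonalEnvelopedLevelCoverKaehler
import Summits.HodgeConjecture.HodgeConjecture.Theorems.EndoscopicMiddleDegreeOrthogonalEnvelopedModelKaehlerCompact
import Summits.HodgeConjecture.HodgeConjecture.Theorems.EndoscopicMiddleDegreeOrthogonalEnvelopedHodgeTypeDescent
import Summits.HodgeConjecture.HodgeConjecture.Theorems.EndoscopicMiddleDegreeOrthogonalEnvelopedCoverMapHolomorphic
import Summits.HodgeConjecture.HodgeConjecture.Theorems.EndoscopicMiddleDegreeOrthogonalEnvelopedHeckeHodgeType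
import Summits.HodgeConjecture.HodgeConjecture.Theorems.EndoscopicMiddleDegreeOrthogonalEnvelopedCoverMapHecke
import Summits.HodgeConjecture.HodgeConjecture.Theorems.EndoscopicMiddleDegreeOrthogonalEnvelopedDeepLevel
import Summits.HodgeConjecture.HodgeConjecture.Theorems.EndoscopicMiddleDegreeOrthogonalEnvelopedLevelDeepHecke
import Summits.HodgeConjecture.HodgeConjecture.Theorems.EndoscopicMiddleDegreeOrthogonalEnvelopedHeckeRing
import Literature.AlgebraicGeometry.HodgeTheory.HodgeTypeConjugation
import Literature.AlgebraicGeometry.HodgeTheory.HodgeModelExistenceProofs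
import Literature.AlgebraicGeometry.Motives.HodgeDecompositionIsInternalDischarge
import Literature.AlgebraicGeometry.Motives.GAGAKaehlerImmersionProofs
import Literature.Geometry.Manifold.CoveringSpaceManifold
import Literature.Geometry.Kaehler.KaehlerPullback
import Literature.NumberTheory.Transcendental.ComplexFormsPullback
import Literature.AlgebraicTopology.SingularHomology.FreeActionLefschetzNumber

/-!
# Line `purity-sorted-hecke-envelope` for crux `EndoscopicMiddleDegree.OrthogonalEnveloped`
# (stmt-HodgeConjecture-14300) — LEAD's skeleton, rev c6-L3 (seventh lead lineage, seat c6, cycle 1, 2026-08-16)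

THE CRUX (rank 4; decl `Summit.HodgeConjecture.HodgeConjecture.Theses.EndoscopicMiddleDegree.OrthogonalEnveloped`,
never restated here): for an orientation family `μ` with Poincaré duality, `m ∈ {1,2}` (`n = m + 1`,
`dim X = 2n`), a datum `D : UnitaryBallQuotientDatum (2n) X` and a RATIONAL class `e ∈ H²ⁿ(X(ℂ); ℂ)`
of Hodge type `(n,n)` cup-orthogonal to the theta world `TW(D)`, there is
`γ ∈ algebraicClasses (X ⊗ X) (2n)` whose action `P_γ β = pr₁₊(pr₂^* β ∪ γ)` (the tree's
`corrAction μ hX hX rfl γ`, `rfl`) preserves rational classes, has purely `(n,n)` image and fixes `e`.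

THE LINE (cards `Ideas/purity-sorted-hecke-envelope.md`, `Lines/purity-sorted-hecke-envelope.md`; seat -1's
rev 4 composition kept verbatim): SORT THE ℚ-BLOCKS OF THE HECKE ALGEBRA BY THE HODGE PURITY OF THEIR IMAGE.
`𝓗 := Algebra.adjoin ℂ (range (D.heckeCorrespondenceAction (2n)))`; its ℚ-blocks `ε` (`stub_rationalBlocks`,
LANDED p87916, imported) are actions `P_{γ_ε}` of ALGEBRAIC classes (`HeckeGraphChow.heckeGraphAlgebraic`,
LANDED p111880 UNCONDITIONAL, imported; the Hecke algebra is the SPAN of the `T_g` by the Hecke ring, Stubs H1–H3);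
the envelope of `e` is `γ := Σ_{ε PURE} γ_ε`; `P_γ e = e − Σ_{ε IMPURE} ε e` and every impure ℚ-block kills
`e`: a KILLED one by the sieve (`stub_killedBarren`, LANDED p96373, imported; needs `heckeHodgeType`),
an un-killed one (a CORE) by `stub_coreVanishing`, THE BET (= Disproof F5's NoImpureRationalComponents on F5b's
wide cores; HC-strength).

RESHAPE rev c6-L1 (this lineage; see `Cruxes/OrthogonalEnveloped/PICKED.md`): the registered named-fact stub
`stub_grothendieckConiveau` (Grothendieck 1969; its only use was `heckeHodgeType`) is ELIMINATED in favour of a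
direct ANALYTIC proof that the Hecke operators preserve Hodge types, assembled by the lead
(`isOfHodgeType_heckeCorrespondenceAction_analytic`) from five stubs none of which is a named fact:
`T_g = [Γ':N]⁻¹ τ ∘ π_g^*` on the level cover `N \ 𝔹 → X(ℂ)` (`levelProj_map_heckeCorrespondenceAction`,
proved); the complex structure of a Hodge model `A` of `X` lifts to `N \ 𝔹` along the covering
(`Literature.Geometry.Manifold.liftChartedSpace`, Lee Prop. 4.40, proved); every branch `N[v] ↦ Γ[g γ v]` is
holomorphic (`stub_coverMapHolomorphic`, from c3's `stub_unifHolomorphic`/`stub_unifSliceSection`/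
`stub_sectionHolomorphicOfInjOn`); holomorphic pull-backs preserve `H^{p,q}` (`map_mem_hodgePQ`, proved) and the
comparison `A.deRham` is natural; `N \ 𝔹` is compact Hausdorff (`stub_levelCoverCompactT2`) and Kähler
(`stub_levelCoverKaehler`, pulling back a Kähler metric of `A.carrier`, `stub_modelKaehlerCompact`), so BOTH carry
the Hodge decomposition (`Motives.isInternal_hodgePQ_holds`, PROVED in the tree) and Hodge types DESCEND along the
injective `π^*` (`stub_hodgeTypeDescent`).

RESHAPE rev c6-L2 (same cycle): the shared stub `stub_cupTriple` (= route item 14350 `CupProductAlgebraic`, used only to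
make the actions of algebraic self-correspondences a SUBALGEBRA, `stub_corrAlgebra`) is ELIMINATED too: the Hecke
algebra `Algebra.adjoin ℂ {T_g}` is the SPAN of the `T_g` (`adjoin_hecke_le_span`) because products of Hecke
operators are combinations of Hecke operators (`heckeMul_mem_span`, the Hecke ring, assembled by the lead from three
covering-space stubs `stub_levelDeep_map_hecke` (H1), `stub_coverMap_map_hecke` (H2), `stub_exists_deepLevel` (H3):
read `T_g T_h` on a common deep level `M ⊴ Γ`, where `π_M^*` is injective), and `γ ↦ P_γ` is linear, so every
ℚ-block is the action of an algebraic class by `heckeGraphAlgebraic` alone. `stub_coreVanishing` (the bet) is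
byte-identical to rev c5-L1; the composition `OrthogonalEnveloped_of` is otherwise unchanged. After this reshape the
line is CLOSED MODULO THE BET ALONE. Disproof used: F4 (both `IsRationalClass e`, `IsOfHodgeType e` consumed), F1/F1′

STATE rev c6-L3 (consolidation, same cycle): ALL NINE stubs of the two reshapes are LANDED (L1 p117415, L2 p117604, L3 p117401,
L4 p117402, L5 p117540; H1 p118219, H2 p117775, H3 p117739) and so are the lead's two assemblies (`heckeHodgeType` p118087,
`heckeMul_mem_span`/`adjoin_hecke_le_span` Theorems/…HeckeRing.lean); they are IMPORTED here. The skeleton's only `sorry` is THE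
BET `stub_coreVanishing`; its durable form is `Theorems/…OfBetAlone.lean` (`orthogonalEnveloped_of_bet`: the bet, verbatim, ALONE
implies the crux; `impureBlocksBarren_of_bet`: the bet ⟹ NoImpureRationalComponents, unconditionally).
(nothing here is refuted by the landed Negative/EnvelopeOfAlgebraic), F5b delimits the bet, F2/F3 (`μ` carried
through), F7 (⊥TW handed to the bet only).
-/

noncomputable section

-- The crux-workfile namespace `Summit.<P>.<Sub>.Cruxes.…` repeats `HodgeConjecture` (single-conjunct summit).
set_option linter.dupNamespace false

namespace Summit.HodgeConjecture.HodgeConjecture.Cruxes.OrthogonalEnveloped.PuritySortedHeckeEnvelope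

open scoped BigOperators Manifold ContDiff
open CategoryTheory MonoidalCategory CartesianMonoidalCategory
open Literature.AlgebraicGeometry.Motives (SchemeOver ComplexPoints IsSmoothProjective)
open Literature.AlgebraicGeometry.Motives (IsSmoothProjective.tensor_holds)
open Literature.AlgebraicGeometry.HodgeTheory
open Literature.AlgebraicGeometry.ShimuraVarieties
open Literature.AlgebraicTopology.SingularHomology
open Literature.NumberTheory.Transcendental (ComplexDeRhamIsoFamily complexDeRhamCohomology hodgePQ
  map_mem_hodgePQ)
open Literature.Geometry.Manifold (liftChartedSpace coveringPiece isManifold_of_atlas_eq_lift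
  contMDiff_proj_of_chartAt_eq)
open Literature.Geometry.Kaehler (IsKaehlerManifold)
open Summit.HodgeConjecture.HodgeConjecture.Theses.EndoscopicMiddleDegree (OrthogonalEnveloped)
open Summit.HodgeConjecture.HodgeConjecture.Cruxes.MiddleThetaSpan.ConjugateDimensionSieve
  (IsCentralIdempotent IsPrimitiveCentralIdempotent exists_primitiveCentralIdempotents conjAct)
open Summit.HodgeConjecture.HodgeConjecture.Cruxes.OrthogonalEnveloped.ImpureBarrenEnvelope
  (stub_rationalBlocks)
open Summit.HodgeConjecture.HodgeConjecture.Cruxes.OrthogonalEnveloped.HeckeGraphChow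
  (heckeGraphAlgebraic stub_properlyDiscontinuous isCancelSMul_ball stub_ballLocallyCompactT2
    isHeckeAdmissible_of_mem_unitaryGroup stub_finiteIndexHeckeLevel
    stub_levelCoveringOfProperlyDiscontinuous)

/-! ## The registered stubs (signatures in tree vocabulary; provers keep them BYTE-IDENTICAL) -/

/-- **Stub 5 — CORE VANISHING (THE BET of the whole route; = Disproof F5's NoImpureRationalComponents
on F5b's closed list of wide cores; implied by HC on the sector + irreducibility of `r(Ψ_a)`
(Calegari–Gee `a ≤ 5` / Patrikis–Taylor), by nothing less in print; hardest stub).** Let `m ∈ {1,2}`,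
`D` a datum and `ε` a ℚ-BLOCK of the Hecke algebra `𝓗` (in `𝓗`, idempotent, central, preserving
rational classes, primitive among the rational-preserving central idempotents — the shape of the
landed `stub_rationalBlocks`) which is IMPURE (some `ε β` is not of type `(n,n)`) and NOT KILLED: some
ℂ-block `z ≤ ε` carries a non-zero `(n,n)`-class in the image of EVERY coefficient-conjugate
`conjEnd σ z`, `σ ∈ Aut(ℂ)` (the ℂ-blocks below a ℚ-block form one `Aut(ℂ)`-orbit, so then all of them
do: `ε` is a CORE — every conjugate constituent meets `H^{n,n}`, some carries another type). Then `ε`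
kills every rational `(n,n)`-class `e` cup-orthogonal to the theta world
`TW(D) = SCⁿ ⊔ SConⁿ ⊔ Hdg^{m,m}_ℚ · N¹` (the crux's hypothesis, verbatim; inert on paper — cores are
discrete-series-only and GGP-invisible, hence automatically `⊥ TW(D)` — kept because it is free).
Paper content: by Matsushima + Arthur–Mok–KMSW + Adams–Johnson (AMR arXiv:1507.01432 §8) the impure,
un-killed ℚ-pieces meeting `H^{n,n}` are exactly those whose coordinate-`0` summand at `τ₁` is cuspidal
`Ψ_a`, `a ≥ 2` (`m = 1`: `Ψ₅`, `Ψ₄ ⊞ χ`, `Ψ₃ ⊞ Ψ₂`, `Ψ₃ ⊞ χ ⊞ χ'`, `Ψ₂ ⊞ …`; `m = 2`: `Ψ_a ⊞ ψ'`,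
`2 ≤ a ≤ 7`, incl. non-tempered `Ψ₃ ⊞ ρ⊠R₂`); a rational `(n,n)`-class there is a Hodge class in a motive
whose `ℓ`-adic realisation has no Tate line — `¬HC`-grade. WHY IT MIGHT FAIL: one rational `(2,2)`-class
in one core of one compact `U(4,1)`-quotient (likeliest `Ψ₄ ∋ 0 ⊞ χ₀`); no tool short of
"Hodge ⟹ Tate-type" for these motives. [cite: BergeronMillsonMoeglin2016Balls, Part 2 §1.9 and Thm. 61]
[cite: arXiv:1507.01432, §8] [cite: arXiv:1804.05047, Thm. 1.2] -/
theorem stub_coreVanishing :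
    ∀ (m : ℕ) (X : SchemeOver ℂ) (D : UnitaryBallQuotientDatum (2 * (m + 1)) X), 1 ≤ m → m ≤ 2 →
      ∀ ε : Module.End ℂ (complexBetti X (2 * (m + 1))),
        ε ∈ Algebra.adjoin ℂ (Set.range (D.heckeCorrespondenceAction (2 * (m + 1)))) →
        ε * ε = ε →
        (∀ T ∈ Algebra.adjoin ℂ (Set.range (D.heckeCorrespondenceAction (2 * (m + 1)))),
          T * ε = ε * T) →
        (∀ β, IsRationalClass β → IsRationalClass (ε β)) →
        (∀ f ∈ Algebra.adjoin ℂ (Set.range (D.heckeCorrespondenceAction (2 * (m + 1)))),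
          f * f = f →
          (∀ T ∈ Algebra.adjoin ℂ (Set.range (D.heckeCorrespondenceAction (2 * (m + 1)))),
            T * f = f * T) →
          (∀ β, IsRationalClass β → IsRationalClass (f β)) → f * ε = 0 ∨ f * ε = ε) →
        (∃ β, ¬ IsOfHodgeType (2 * (m + 1)) X (2 * (m + 1)) (m + 1) (m + 1) (ε β)) →
        (∃ z : Module.End ℂ (complexBetti X (2 * (m + 1))),
          IsPrimitiveCentralIdempotent
              (Algebra.adjoin ℂ (Set.range (D.heckeCorrespondenceAction (2 * (m + 1))))) z ∧
            z * ε = z ∧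
              ∀ σ : ℂ ≃+* ℂ, ∃ c : complexBetti X (2 * (m + 1)),
                IsOfHodgeType (2 * (m + 1)) X (2 * (m + 1)) (m + 1) (m + 1) (conjEnd σ z c) ∧
                  conjEnd σ z c ≠ 0) →
        ∀ e : complexBetti X (2 * (m + 1)), IsRationalClass e →
          IsOfHodgeType (2 * (m + 1)) X (2 * (m + 1)) (m + 1) (m + 1) e →
          (∀ x ∈ ((⨆ (W : Submodule D.E (Fin (2 * (m + 1) + 1) → D.E))
              (_ : IsTotallyPositive (conjRingHom D.E) D.H W) (_ : Module.finrank D.E W = m + 1),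
              classesSupportedOn X (D.specialSubvariety W) (2 * (m + 1))) ⊔
            (⨆ (W : Submodule D.E (Fin (2 * (m + 1) + 1) → D.E))
              (_ : IsTotallyPositive (conjRingHom D.E) D.H W) (_ : Module.finrank D.E W = m)
              (Z : Set X.left) (_ : IsClosed Z) (_ : Z ⊆ D.specialSubvariety W)
              (_ : ∀ z ∈ Z, ((m + 1 : ℕ) : ℕ∞) ≤ Order.coheight z),
              classesSupportedOn X Z (2 * (m + 1))) ⊔
            Submodule.span ℂ {z : complexBetti X (2 * (m + 1)) |
              ∃ a : complexBetti X (2 * m), IsRationalClass a ∧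
                IsOfHodgeType (2 * (m + 1)) X (2 * m) m m a ∧
                ∃ d ∈ algebraicClasses X 1,
                  z = cupProduct (two_mul_add_two_mul m 1) a d}),
            cupProduct (two_mul_add_two_mul (m + 1) (m + 1)) e x = 0) →
          ε e = 0 := by
  sorry

/-! ### The five analytic/topological stubs replacing `stub_grothendieckConiveau` (rev c6-L1)

Common setting: a datum `D : UnitaryBallQuotientDatum p X`, a Hodge model `A` of `X` (complex manifold
`A.carrier` charted on `A.model ≅ ℂᵖ`, `φ := A.isAnalytification.isHomeomorph.homeomorph : A.carrier ≃ₜ X(ℂ)`),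
a normal subgroup `N ⊴ Γ` and its level cover `L := D.LevelCover N = N \ 𝔹` with projection
`pL := φ.symm ∘ D.levelProj N : L → A.carrier`, a local homeomorphism as soon as `D.levelProj N` is a covering
map; `L` carries the LIFTED atlas `liftChartedSpace hp` (chart at `ℓ` = (piece of `pL` at `ℓ`) ≫ (chart of
`A.carrier` at `pL ℓ`), Lee 2012 Prop. 4.40), for which it is a complex manifold and `pL` a local biholomorphism
(`isManifold_of_atlas_eq_lift`, `contMDiff_proj_of_chartAt_eq`, proved in `Literature/Geometry/Manifold/
CoveringSpaceManifold`). -/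

/-! ## The Hecke ring: `heckeMul_mem_span`, `adjoin_hecke_le_span`, LANDED (Theorems/…HeckeRing.lean, imported; rev c6-L2) -/

/-! ## The Hecke algebra preserves Hodge types: `heckeHodgeType`, LANDED p118087 (imported; unconditional since rev c6-L1) -/

/-! ## The composition -/

/-- **The crux from the stubs** (line `purity-sorted-hecke-envelope`). With the ℚ-blocks `ε` of the
Hecke algebra (`stub_rationalBlocks`, landed), each the action of an algebraic class `γ_ε`
(`heckeGraphAlgebraic`, landed p111880; the Hecke algebra is the span of the `T_g`, `adjoin_hecke_le_span`; it preserves the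
type `(n,n)` by `heckeHodgeType`, unconditional since rev c6-L1), the envelope of a rational `(n,n)`-class `e ⊥ TW(D)`
is `γ := Σ_{ε pure} γ_ε`: its action `Σ_{pure} ε` preserves rational classes, is `(n,n)`-valued, and
fixes `e` because `Σ_ε ε = 1` and every IMPURE block kills `e` — a KILLED one by `stub_killedBarren`
(the sieve), an un-killed one (a core) by `stub_coreVanishing` (the bet). -/
theorem OrthogonalEnveloped_of : OrthogonalEnveloped := by
  intro μ hμ m X D hm1 hm2 e he hH horth
  classical
  -- the ℚ-blocks of the Hecke algebra
  obtain ⟨s, hblk, -, hsum⟩ := stub_rationalBlocks m X D hm1 hm2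
  -- every element of the Hecke algebra is the action of an ALGEBRAIC class: the Hecke algebra is the span of
  -- the `T_g` (`adjoin_hecke_le_span`, from the Hecke ring `heckeMul_mem_span`), each `T_g` is the action of an
  -- algebraic class (`heckeGraphAlgebraic`, landed p111880), and `γ ↦ P_γ` is linear
  have halg : ∀ a ∈ Algebra.adjoin ℂ (Set.range (D.heckeCorrespondenceAction (2 * (m + 1)))),
      ∃ γ ∈ algebraicClasses (X ⊗ X) (2 * (m + 1)),
        corrAction μ D.isSmoothProjective D.isSmoothProjective
          (rfl : 2 * (m + 1) + 2 * (2 * (m + 1)) = 2 * (m + 1) + 2 * (2 * (m + 1))) γ = a := by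
    intro a ha
    have ha' := adjoin_hecke_le_span D _ ha
    clear ha
    induction ha' using Submodule.span_induction with
    | mem T hT =>
      obtain ⟨g, rfl⟩ := hT
      exact heckeGraphAlgebraic μ hμ m X D hm1 hm2 g
    | zero => exact ⟨0, zero_mem _, map_zero _⟩
    | add a b _ _ iha ihb =>
      obtain ⟨γ, hγ, rfl⟩ := iha
      obtain ⟨γ', hγ', rfl⟩ := ihb
      exact ⟨γ + γ', add_mem hγ hγ', map_add _ _ _⟩
    | smul c a _ iha =>
      obtain ⟨γ, hγ, rfl⟩ := iha
      exact ⟨c • γ, Submodule.smul_mem _ c hγ, map_smul _ _ _⟩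
  -- the Hecke algebra preserves the Hodge type `(n,n)` (`heckeHodgeType`, from Stubs L1–L5)
  have hHodge : ∀ a ∈ Algebra.adjoin ℂ (Set.range (D.heckeCorrespondenceAction (2 * (m + 1)))),
      ∀ c : complexBetti X (2 * (m + 1)),
        IsOfHodgeType (2 * (m + 1)) X (2 * (m + 1)) (m + 1) (m + 1) c →
          IsOfHodgeType (2 * (m + 1)) X (2 * (m + 1)) (m + 1) (m + 1) (a c) :=
    fun a ha ↦ heckeHodgeType D ha
  -- each block is the action of an algebraic class
  have hεS : ∀ ε ∈ s, ∃ γ ∈ algebraicClasses (X ⊗ X) (2 * (m + 1)),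
      corrAction μ D.isSmoothProjective D.isSmoothProjective
        (rfl : 2 * (m + 1) + 2 * (2 * (m + 1)) = 2 * (m + 1) + 2 * (2 * (m + 1))) γ = ε :=
    fun ε hε ↦ halg ε (hblk ε hε).1
  choose! γf hγf hPγ using hεS
  -- the pure blocks and the envelope
  let pure : Module.End ℂ (complexBetti X (2 * (m + 1))) → Prop :=
    fun ε ↦ ∀ β, IsOfHodgeType (2 * (m + 1)) X (2 * (m + 1)) (m + 1) (m + 1) (ε β)
  have hP : corrAction μ D.isSmoothProjective D.isSmoothProjective
      (rfl : 2 * (m + 1) + 2 * (2 * (m + 1)) = 2 * (m + 1) + 2 * (2 * (m + 1)))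
      (∑ ε ∈ s.filter pure, γf ε) = ∑ ε ∈ s.filter pure, ε := by
    rw [map_sum]
    exact Finset.sum_congr rfl fun ε hε ↦ hPγ ε (Finset.mem_filter.1 hε).1
  refine ⟨∑ ε ∈ s.filter pure, γf ε,
    Submodule.sum_mem _ fun ε hε ↦ hγf ε (Finset.mem_filter.1 hε).1, ?_⟩
  intro P
  have hPβ : ∀ β, P β = ∑ ε ∈ s.filter pure, ε β := fun β ↦ by
    change corrAction μ D.isSmoothProjective D.isSmoothProjective
      (rfl : 2 * (m + 1) + 2 * (2 * (m + 1)) = 2 * (m + 1) + 2 * (2 * (m + 1)))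
      (∑ ε ∈ s.filter pure, γf ε) β = _
    rw [hP, LinearMap.sum_apply]
  obtain ⟨A, -⟩ := id hH
  refine ⟨fun β hβ ↦ ?_, fun β ↦ ?_, ?_⟩
  · -- rational classes are preserved: each ℚ-block preserves them
    rw [hPβ]
    exact Finset.sum_induction _ (fun x ↦ IsRationalClass x) (fun a b ha hb ↦ ha.add hb)
      IsRationalClass.zero (fun ε hε ↦ (hblk ε (Finset.mem_filter.1 hε).1).2.2.2.1 β hβ)
  · -- the image is purely `(n,n)`: a sum of `(n,n)`-classes (pure blocks, by definition)
    rw [hPβ]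
    exact IsOfHodgeType.sum D.isSmoothProjective A _ _ fun ε hε ↦ (Finset.mem_filter.1 hε).2 β
  · -- `e` is fixed: `e = Σ_ε ε e`, and every impure block — killed or core — kills `e`
    rw [hPβ]
    have he_sum : e = ∑ ε ∈ s, ε e := by
      conv_lhs => rw [show e = (∑ ε ∈ s, ε) e by rw [hsum]; rfl]
      rw [LinearMap.sum_apply]
    have hzero : ∑ ε ∈ s.filter (fun ε ↦ ¬ pure ε), ε e = 0 := by
      refine Finset.sum_eq_zero fun ε hε ↦ ?_
      obtain ⟨hεs, hnp⟩ := Finset.mem_filter.1 hε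
      obtain ⟨h1, h2, h3, h4, h5⟩ := hblk ε hεs
      by_cases hK : ∀ z : Module.End ℂ (complexBetti X (2 * (m + 1))),
          IsPrimitiveCentralIdempotent
              (Algebra.adjoin ℂ (Set.range (D.heckeCorrespondenceAction (2 * (m + 1))))) z →
            z * ε = z →
              ∃ σ : ℂ ≃+* ℂ, ∀ c : complexBetti X (2 * (m + 1)),
                IsOfHodgeType (2 * (m + 1)) X (2 * (m + 1)) (m + 1) (m + 1) (conjEnd σ z c) →
                  conjEnd σ z c = 0
      · -- (K) a KILLED block: barren by the sieve
        exact stub_killedBarren m X D hm1 hm2 hHodge ε h1 h2 h3 hK e he hH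
      · -- (C) a CORE: barren by the bet
        push Not at hK
        exact stub_coreVanishing m X D hm1 hm2 ε h1 h2 h3 h4 h5 (not_forall.1 hnp) hK e he hH horth
    conv_rhs => rw [he_sum, ← Finset.sum_filter_add_sum_filter_not s pure]
    rw [hzero, add_zero]

/-- The crux, by name (alias of `OrthogonalEnveloped_of` in the shape the skeleton checker asks for). -/
theorem OrthogonalEnveloped_proof : OrthogonalEnveloped := OrthogonalEnveloped_of

end Summit.HodgeConjecture.HodgeConjecture.Cruxes.OrthogonalEnveloped.PuritySortedHeckeEnvelope

end
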